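import Literature.RingTheory.MvPolynomial.MacaulayHilbertGrowth
import HarnessLib

/-!
# Macaulay's characterization of Hilbert functions (Bruns–Herzog Thm. 4.2.10, all directions)

`MacaulayHilbertGrowth.lean` proves Bruns–Herzog Thm. 4.2.10 (a) ⇒ (c): the Hilbert function `H`
of `K[X_0, …, X_{N-1}]/I`, `I` homogeneous, satisfies `H(d + 1) ≤ H(d)^⟨d⟩` for `d ≥ 1`. This
file proves the converse (c) ⇒ (d) ⇒ (b) ⇒ (a): every numerical function with `h 0 = 1`,
`h 1 ≤ N` and `h (d + 1) ≤ (h d)^⟨d⟩` (`d ≥ 1`) is the Hilbert function of a MONOMIAL ideal of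
`K[X_0, …, X_{N-1}]` — namely of the lex-segment ideal spanned by the lex segments
`L_d ⊆ Mon_d`, `#L_d = #Mon_d - h d`, which satisfy `∇L_d ⊆ L_{d+1}` by Cor. 4.2.9 — and packages
the theorem as a description of the tree's set `HF K N` of Hilbert functions of standard graded
`K`-algebras with `N` generators (`Literature.RingTheory.HilbertSamuel.HF`, CJS Thm. 2.15):

* `upper_card_Mon` — `(#Mon_d)^⟨d⟩ = #Mon_{d+1}` (`d ≥ 1`);
* `le_card_Mon_of_macaulay` — a Macaulay function with `h 0 = 1`, `h 1 ≤ N` has `h d ≤ #Mon_d`;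
* `exists_upperSet_hilbertFun_eq` — **(c) ⇒ (d)**: such `h` is `F(E)` for an upper set
  `E ⊆ ℕ^N` of exponents (the complement of an order ideal of monomials);
* `exists_monomialIdeal_hilbertFunQuot_eq` — **(c) ⇒ (b)**: it is the Hilbert function of
  `S/J`, `J` a monomial ideal;
* `mem_HF_iff` — **Thm. 4.2.10 for `N` variables**:
  `H ∈ HF K N ↔ H = 0 ∨ (H 0 = 1 ∧ H 1 ≤ N ∧ ∀ d ≥ 1, H (d + 1) ≤ H(d)^⟨d⟩)`
  (`H = 0` is the unit ideal, which `HF` allows).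

## References

* [BrunsHerzog1998] W. Bruns, J. Herzog, *Cohen–Macaulay rings*, rev. ed., Cambridge Studies in
  Advanced Mathematics 39 (1998), §4.2: Cor. 4.2.9, Thm. 4.2.10 and its proof ((c) ⇒ (d):
  "`⋃ ℒ_{h(n)}` is an order ideal", (d) ⇒ (b)).
* [CossartJannsenSaito2020] V. Cossart, U. Jannsen, S. Saito, LNM 2270 (2020), Thm. 2.15 (the set
  `HF_N`).
-/

open Finset Literature.RingTheory.GradedAlgebra.Macaulay

namespace Literature.RingTheory.MvPolynomial.Macaulay

variable {n : ℕ}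

/-! ## Numerical preliminaries -/

/-- `(#Mon_d)^⟨d⟩ = #Mon_{d+1}` for `d ≥ 1` (in `n + 1` variables): Cor. 4.2.9 for the empty lex
segment. [cite: BrunsHerzog1998, Cor. 4.2.9] -/
theorem upper_card_Mon {d : ℕ} (hd : 1 ≤ d) :
    upper d (Mon (n + 1) d).card = (Mon (n + 1) (d + 1)).card := by
  have hL : IsLexSeg (∅ : Finset (Fin (n + 1) → ℕ)) d :=
    ⟨empty_subset _, fun a ha => absurd ha (Finset.notMem_empty a)⟩
  have h := card_Mon_succ_sub_card_shadow hd hL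
  have hsh : shadow (∅ : Finset (Fin (n + 1) → ℕ)) = ∅ := by simp [shadow]
  rw [hsh, card_empty, Nat.sub_zero, Nat.sub_zero] at h
  exact h.symm

/-- A function with `h 0 = 1`, `h 1 ≤ n + 1` and Macaulay growth is bounded by `#Mon_d`
(monomials in `n + 1` variables). [cite: BrunsHerzog1998, Thm. 4.2.10 (proof of (c) ⇒ (d))] -/
theorem le_card_Mon_of_macaulay {h : ℕ → ℕ} (h0 : h 0 = 1) (h1 : h 1 ≤ n + 1)
    (hmac : ∀ d, 1 ≤ d → h (d + 1) ≤ upper d (h d)) : ∀ d, h d ≤ (Mon (n + 1) d).card := by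
  intro d
  induction d with
  | zero => rw [h0, card_Mon]; simp
  | succ d ih =>
    rcases Nat.eq_zero_or_pos d with rfl | hd
    · rw [card_Mon]; simpa using h1
    · exact (hmac d hd).trans ((upper_mono d ih).trans (upper_card_Mon hd).le)

/-- `Mon N d` is the image of Mathlib's `finsuppAntidiag`. [folklore] -/
private theorem Mon_eq_map_antidiag (N d : ℕ) :
    Mon N d = ((univ : Finset (Fin N)).finsuppAntidiag d).map
      Finsupp.equivFunOnFinite.toEmbedding := by
  ext u
  simp only [mem_map_equiv, mem_finsuppAntidiag, mem_Mon]
  constructor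
  · intro hu
    exact ⟨by simpa [Finsupp.equivFunOnFinite] using hu, subset_univ _⟩
  · rintro ⟨hu, -⟩
    simpa [Finsupp.equivFunOnFinite] using hu

/-! ## (c) ⇒ (d): a lex-segment upper set with prescribed Hilbert function -/

open Literature.RingTheory.HilbertSamuel in
/-- **Bruns–Herzog Thm. 4.2.10, (c) ⇒ (d).** If `h 0 = 1`, `h 1 ≤ N` and
`h (d + 1) ≤ (h d)^⟨d⟩` for all `d ≥ 1`, then `h = F(E)` for an upper set `E ⊆ ℕ^N` of exponents
(`F(E)(d) = #Mon_d - #E_d`; `E` is the union of the lex segments `L_d ⊆ Mon_d` with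
`#L_d = #Mon_d - h d`, an upper set because `∇L_d ⊆ L_{d+1}` by Cor. 4.2.9).
[cite: BrunsHerzog1998, Thm. 4.2.10 (c) ⇒ (d)] -/
theorem exists_upperSet_hilbertFun_eq {N : ℕ} {h : ℕ → ℕ} (h0 : h 0 = 1) (h1 : h 1 ≤ N)
    (hmac : ∀ d, 1 ≤ d → h (d + 1) ≤ upper d (h d)) :
    ∃ E : UpperSet (Fin N →₀ ℕ), upperSetHilbertFun N E = h := by
  classical
  rcases Nat.eq_zero_or_pos N with rfl | hN
  · -- no variables: `h = (1, 0, 0, …) = F(∅)`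
    have hz : ∀ d, 1 ≤ d → h d = 0 := by
      intro d hd
      induction d, hd using Nat.le_induction with
      | base => omega
      | succ d hd ih =>
        have := hmac d hd
        rw [ih, upper_zero] at this
        omega
    refine ⟨⟨∅, isUpperSet_empty⟩, funext fun d => ?_⟩
    rcases Nat.eq_zero_or_pos d with rfl | hd
    · simp [upperSetHilbertFun, h0]
    · have hd' : d ≠ 0 := by omega
      simp [upperSetHilbertFun, hz d hd, hd']
  · obtain ⟨n, rfl⟩ : ∃ n, N = n + 1 := ⟨N - 1, by omega⟩
    have hle := le_card_Mon_of_macaulay h0 h1 hmac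
    -- lex segments `L d ⊆ Mon_d` with `#L d = #Mon_d - h d`
    have hex : ∀ d, ∃ L : Finset (Fin (n + 1) → ℕ),
        IsLexSeg L d ∧ L.card = (Mon (n + 1) d).card - h d :=
      fun d => exists_isLexSeg_card_eq d _ (Nat.sub_le _ _)
    choose L hL hcard using hex
    have hdeg : ∀ {a : Fin (n + 1) → ℕ} {d : ℕ}, a ∈ L d → ∑ i, a i = d :=
      fun ha => mem_Mon.1 ((hL _).1 ha)
    -- `∇(L d) ⊆ L (d + 1)` for `d ≥ 1` (Cor. 4.2.9 and nesting of lex segments)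
    have hsub : ∀ d, 1 ≤ d → shadow (L d) ⊆ L (d + 1) := by
      intro d hd
      have h1 := card_Mon_succ_sub_card_shadow hd (hL d)
      rw [hcard d, Nat.sub_sub_self (hle d)] at h1
      have h2 : (shadow (L d)).card ≤ (Mon (n + 1) (d + 1)).card :=
        card_le_card (shadow_subset_Mon (hL d).1)
      refine (isLexSeg_shadow (hL d)).subset_of_card_le (hL (d + 1)) ?_
      rw [hcard (d + 1)]
      have := hmac d hd
      omega
    -- the union `S` of the `L d`, `d ≥ 1`, is closed under multiplication by monomials
    let S : Set (Fin (n + 1) → ℕ) := {a | ∃ d, 1 ≤ d ∧ a ∈ L d}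
    have hS_up : ∀ a c : Fin (n + 1) → ℕ, a ∈ S → a ≤ c → c ∈ S := by
      suffices ∀ t, ∀ a c : Fin (n + 1) → ℕ, ∑ i, c i = t → a ∈ S → a ≤ c → c ∈ S from
        fun a c => this _ a c rfl
      intro t
      induction t using Nat.strong_induction_on with
      | _ t ih =>
        intro a c hct ha hac
        by_cases hne : a = c
        · exact hne ▸ ha
        · obtain ⟨i, hi⟩ : ∃ i, a i < c i := by
            by_contra! hcon
            exact hne (funext fun j => le_antisymm (hac j) (hcon j))
          have hci : 0 < c i := lt_of_le_of_lt (Nat.zero_le _) hi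
          have hlt : ∑ j, (c - e i) j < t := by
            have h1 : ∑ j, (c - e i) j + 1 = ∑ j, c j := by
              conv_rhs => rw [← sub_e_add_e hci, sum_add_e]
            omega
          have hle' : a ≤ c - e i := by
            intro j
            simp only [Pi.sub_apply, e, Pi.single_apply]
            split_ifs with hj
            · subst hj; omega
            · simpa using hac j
          obtain ⟨d, hd, hmem⟩ := ih _ hlt a (c - e i) rfl ha hle'
          refine ⟨d + 1, by omega, ?_⟩
          have hc := hsub d hd (add_e_mem_shadow hmem i)
          rwa [sub_e_add_e hci] at hc
    -- the upper set of exponents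
    let E : UpperSet (Fin (n + 1) →₀ ℕ) :=
      ⟨{a | (⇑a : Fin (n + 1) → ℕ) ∈ S}, fun a b hab ha => hS_up _ _ ha fun i => Finsupp.le_def.1 hab i⟩
    have hmemE : ∀ a : Fin (n + 1) →₀ ℕ, a ∈ E ↔ (⇑a : Fin (n + 1) → ℕ) ∈ S := fun a => Iff.rfl
    refine ⟨E, funext fun d => ?_⟩
    rcases Nat.eq_zero_or_pos d with rfl | hd
    · -- degree `0`: `1 ∉ J`
      have h0E : (0 : Fin (n + 1) →₀ ℕ) ∉ E := by
        intro hmem0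
        obtain ⟨d, hd, hmem⟩ := (hmemE 0).1 hmem0
        have := hdeg hmem
        simp at this
        omega
      simp only [upperSetHilbertFun, finsuppAntidiag_zero, card_singleton]
      rw [filter_false_of_mem fun x hx => by rw [mem_singleton] at hx; rw [hx]; exact h0E,
        card_empty, h0]
    · -- degree `d ≥ 1`: the degree-`d` exponents of `E` are `L d`
      have hLd : L d = (Mon (n + 1) d).filter fun a => a ∈ S := by
        ext a
        simp only [mem_filter]
        constructor
        · intro ha
          exact ⟨(hL d).1 ha, d, hd, ha⟩
        · rintro ⟨haM, d', -, ha'⟩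
          have hdd : d' = d := by rw [← hdeg ha', ← mem_Mon.1 haM]
          subst hdd
          exact ha'
      have hcardE : (((univ : Finset (Fin (n + 1))).finsuppAntidiag d).filter (· ∈ E)).card =
          (L d).card := by
        rw [hLd, Mon_eq_map_antidiag, filter_map, card_map]
        congr 1
      rw [upperSetHilbertFun, hcardE, ← card_map Finsupp.equivFunOnFinite.toEmbedding,
        ← Mon_eq_map_antidiag, hcard d, Nat.sub_sub_self (hle d)]

/-! ## (c) ⇒ (b), and the description of `HF` -/

open Literature.RingTheory.HilbertSamuel Literature.Order.WellQuasiOrder in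
/-- **Bruns–Herzog Thm. 4.2.10, (c) ⇒ (b).** A function with `h 0 = 1`, `h 1 ≤ N` and Macaulay
growth is the Hilbert function of `K[X_0, …, X_{N-1}]/J` for a MONOMIAL ideal `J`.
[cite: BrunsHerzog1998, Thm. 4.2.10 (c) ⇒ (b)] -/
theorem exists_monomialIdeal_hilbertFunQuot_eq (K : Type*) [Field K] {N : ℕ} {h : ℕ → ℕ}
    (h0 : h 0 = 1) (h1 : h 1 ≤ N) (hmac : ∀ d, 1 ≤ d → h (d + 1) ≤ upper d (h d)) :
    ∃ E : UpperSet (Fin N →₀ ℕ),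
      hilbertFunQuot K N (monomialIdeal K (E : Set (Fin N →₀ ℕ))) = h := by
  obtain ⟨E, hE⟩ := exists_upperSet_hilbertFun_eq h0 h1 hmac
  exact ⟨E, (hilbertFunQuot_monomialIdeal E).trans hE⟩

open Literature.RingTheory.HilbertSamuel in
/-- **Macaulay's theorem (Bruns–Herzog Thm. 4.2.10) as a description of the set `HF K N` of
Hilbert functions of the standard graded algebras `K[X_0, …, X_{N-1}]/I`** (`I` homogeneous, the
unit ideal allowed): `H ∈ HF K N` iff `H = 0`, or `H 0 = 1`, `H 1 ≤ N` and
`H (d + 1) ≤ H(d)^⟨d⟩` for all `d ≥ 1`. [cite: BrunsHerzog1998, Thm. 4.2.10]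
[cite: CossartJannsenSaito2020, Thm. 2.15 (the set HF_N)] -/
theorem mem_HF_iff (K : Type*) [Field K] (N : ℕ) (H : ℕ → ℕ) :
    H ∈ HF K N ↔ H = 0 ∨ (H 0 = 1 ∧ H 1 ≤ N ∧ ∀ d, 1 ≤ d → H (d + 1) ≤ upper d (H d)) := by
  classical
  rw [HF_eq_range]
  constructor
  · rintro ⟨E, rfl⟩
    by_cases h0 : (0 : Fin N →₀ ℕ) ∈ E
    · -- `1 ∈ J`: the zero function
      left
      have hE : ∀ a : Fin N →₀ ℕ, a ∈ E := fun a =>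
        E.upper (show (0 : Fin N →₀ ℕ) ≤ a from fun i => Nat.zero_le _) h0
      funext d
      simp [upperSetHilbertFun, hE]
    · right
      refine ⟨?_, ?_, fun d hd => upperSetHilbertFun_succ_le_upper N E hd⟩
      · simp only [upperSetHilbertFun, finsuppAntidiag_zero, card_singleton]
        rw [filter_false_of_mem fun x hx => by rw [mem_singleton] at hx; rw [hx]; exact h0,
          card_empty]
      · calc upperSetHilbertFun N E 1
            ≤ ((univ : Finset (Fin N)).finsuppAntidiag 1).card := Nat.sub_le _ _
          _ = N := by
              rw [card_finsuppAntidiag_nat_eq_choose, card_univ, Fintype.card_fin]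
              simp
  · rintro (rfl | ⟨h0, h1, hmac⟩)
    · refine ⟨⟨Set.univ, isUpperSet_univ⟩, funext fun d => ?_⟩
      simp [upperSetHilbertFun]
    · exact exists_upperSet_hilbertFun_eq h0 h1 hmac

end Literature.RingTheory.MvPolynomial.Macaulay
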